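import Summits.AnomalousDissipation.AnomalousDissipation.Theorems.SawtoothPulseCascadeK1LocalisedCascadeAxisKernel
import Summits.AnomalousDissipation.AnomalousDissipation.Theorems.SawtoothPulseCascadeK1LocalisedCascadeZoneJunk

/-!
# K1loc, line `Spectral` / thin start — helper: LATTICE CUT-OFFS ALONG ONE AXIS OF `T^d` (symbol, kernel, sup-norm-paid weights)

Helper file of the prover lane on the crux `K1LocalisedCascade` (stmt-AnomalousDissipation-19491), route
`SawtoothPulseCascade` (S-D fibre ledger, brick B-2).  For a finitely supported symbol `χ : ℤ → ℂ` and an axis `eⱼ` the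
operator `T_χ v = Σ_m χ(m)·A^j_m v` (finite combination of fibre components `A^j_m v(x) = ∫ e_{−m}(s)v(x + s eⱼ)ds` of
`…StripBlock`) is the Fourier multiplier `χ(k_j)` (`mFourierCoeff_axisCutoff`) and the convolution along `eⱼ` with the
circle kernel `k_χ(s) = Σ_m χ(m)e_{−m}(s)` of `…AxisKernel` (`axisCutoff_eq_integral`).  Cauchy–Schwarz against the measure
`|k_χ(s)|ds` (`norm_axisCutoff_sq_le`) and the translation invariance of the torus give the bound the window lemma
(`…FibreWindow`) consumes for its zone term:
  **`∫ ρ(x_j)² ‖T_χ v(x)‖² dx ≤ (∫_T |k_χ|)² · B² · ∫_T ρ²`**   for `‖v‖ ≤ B`   (`integral_weight_mul_norm_axisCutoff_sq_le`),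
— the smooth input split `θ₁ = T_χ θ` of a BOUNDED scalar costs (kernel `L¹` norm)² × (sup norm)² × (mass of the zone
weight), with no symbol-smoothness scale and uniformly in the frequency scale of `χ` (the `L¹` bound of `…AxisKernel`).
No definitions (the operator is written out); no statement about the crux.
[cite: Grafakos2014, Prop. 3.1.2 (5) and Prop. 3.2.7 (3)] [problem: turb]
-/

-- `Summit.<Summit>.<Problem>`: single-conjunct summit, the duplicate namespace segment is deliberate.
set_option linter.dupNamespace false

noncomputable section

namespace Summit.AnomalousDissipation.AnomalousDissipation.Theorems.SawtoothPulseCascade.K1Window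

open MeasureTheory Set Filter Topology UnitAddTorus Function
open Literature.Analysis.FunctionSpaces Literature.Analysis.FunctionSpaces.Torus
open Summit.AnomalousDissipation.AnomalousDissipation.Theorems.SawtoothPulseCascade.K1Start

variable {d : Type*} [Fintype d] [DecidableEq d]

/-! ## §1 The operator `T_χ = Σ χ(m) A^j_m`: symbol and kernel -/

/-- **`T_χ` is the Fourier multiplier `χ(k_j)`**: for continuous `v` and `χ` vanishing off the finite set `S`,
`𝓕(Σ_{m∈S} χ(m) A^j_m v)(k) = χ(k_j)·𝓕v(k)`. [cite: Grafakos2014, Prop. 3.1.2 (5)] -/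
theorem mFourierCoeff_axisCutoff {v : UnitAddTorus d → ℂ} (hv : Continuous v) (j : d) {χ : ℤ → ℂ} {S : Finset ℤ}
    (hχ : ∀ m, m ∉ S → χ m = 0) (k : d → ℤ) :
    mFourierCoeff (fun x => ∑ m ∈ S, χ m * ∫ s : UnitAddCircle, (fourier (-m) s : ℂ) • v (x + Pi.single j s)) k =
      χ (k j) * mFourierCoeff v k := by
  classical
  set A : ℤ → UnitAddTorus d → ℂ := fun m x => ∫ s : UnitAddCircle, (fourier (-m) s : ℂ) • v (x + Pi.single j s) with hA
  have hAc : ∀ m, Continuous (A m) := fun m => continuous_twistedAxisAvg hv j m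
  have hAi : ∀ m ∈ S, Integrable (fun x => χ m * A m x) volume := fun m _ =>
    (continuous_const.mul (hAc m)).integrable_unitAddTorus
  have hsum := Torus.mFourierCoeff_finset_sum S hAi k
  rw [hsum]
  have hterm : ∀ m ∈ S, mFourierCoeff (fun x => χ m * A m x) k = if k j = m then χ m * mFourierCoeff v k else 0 := by
    intro m _
    have h := Torus.mFourierCoeff_const_smul (F := ℂ) (χ m) (A m) k
    simp only [Pi.smul_def, smul_eq_mul] at h
    rw [h, hA, mFourierCoeff_twistedAxisAvg hv j m k]
    split_ifs <;> simp
  rw [Finset.sum_congr rfl hterm]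
  by_cases hk : k j ∈ S
  · rw [Finset.sum_eq_single_of_mem (k j) hk fun m _ hm => by rw [if_neg (Ne.symm hm)], if_pos rfl]
  · rw [Finset.sum_eq_zero fun m hm => if_neg fun h : k j = m => hk (h ▸ hm), hχ _ hk, zero_mul]

omit [Fintype d] in
/-- **Kernel form**: `Σ_{m∈S} χ(m) A^j_m v(x) = ∫_T k_χ(s) · v(x + s eⱼ) ds` with `k_χ(s) = Σ_{m∈S} χ(m)e_{−m}(s)`.
[cite: Grafakos2014, Prop. 3.1.2 (5)] -/
theorem axisCutoff_eq_integral {v : UnitAddTorus d → ℂ} (hv : Continuous v) (j : d) (χ : ℤ → ℂ) (S : Finset ℤ)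
    (x : UnitAddTorus d) :
    ∑ m ∈ S, χ m * ∫ s : UnitAddCircle, (fourier (-m) s : ℂ) • v (x + Pi.single j s) =
      ∫ s : UnitAddCircle, (∑ m ∈ S, χ m * fourier (-m) s) * v (x + Pi.single j s) := by
  have hint : ∀ m : ℤ, Integrable (fun s : UnitAddCircle => χ m * ((fourier (-m) s : ℂ) * v (x + Pi.single j s))) :=
    fun m => (continuous_const.mul ((fourier (-m)).continuous.mul (hv.comp
      (continuous_const.add ((continuous_single j).comp continuous_id))))).integrable_of_hasCompactSupport
      (HasCompactSupport.of_compactSpace _)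
  simp_rw [Finset.sum_mul, smul_eq_mul]
  rw [integral_finsetSum _ fun m _ => ?_]
  · refine Finset.sum_congr rfl fun m _ => ?_
    rw [← integral_const_mul]
    refine integral_congr_ae (Eventually.of_forall fun s => by ring)
  · exact ((hint m).congr (Eventually.of_forall fun s => by ring))

/-! ## §2 Cauchy–Schwarz against `|k_χ(s)| ds` and the sup-norm-paid weighted energy bound -/

omit [Fintype d] in
/-- **Pointwise Cauchy–Schwarz**: `‖∫ k(s)v(x + s eⱼ)ds‖² ≤ (∫|k|) · ∫ |k(s)|·‖v(x + s eⱼ)‖² ds` for continuous `k`, `v`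
(AM–GM `|k|‖v‖ ≤ (t|k| + |k|‖v‖²/t)/2`, then optimise `t`). [folklore] -/
theorem norm_integral_mul_sq_le {k : UnitAddCircle → ℂ} (hk : Continuous k) {v : UnitAddTorus d → ℂ} (hv : Continuous v)
    (j : d) (x : UnitAddTorus d) :
    ‖∫ s : UnitAddCircle, k s * v (x + Pi.single j s)‖ ^ 2 ≤
      (∫ s : UnitAddCircle, ‖k s‖) * ∫ s : UnitAddCircle, ‖k s‖ * ‖v (x + Pi.single j s)‖ ^ 2 := by
  have hvc : Continuous fun s : UnitAddCircle => v (x + Pi.single j s) :=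
    hv.comp (continuous_const.add ((continuous_single j).comp continuous_id))
  have hI : ∀ {f : UnitAddCircle → ℝ}, Continuous f → Integrable f := fun hf =>
    hf.integrable_of_hasCompactSupport (HasCompactSupport.of_compactSpace _)
  set A : ℝ := ∫ s : UnitAddCircle, ‖k s‖ with hA
  set B : ℝ := ∫ s : UnitAddCircle, ‖k s‖ * ‖v (x + Pi.single j s)‖ ^ 2 with hB
  have hA0 : 0 ≤ A := integral_nonneg fun s => norm_nonneg _
  have hB0 : 0 ≤ B := integral_nonneg fun s => by positivity
  -- `‖∫ k v‖ ≤ ∫ |k|‖v‖ ≤ (t/2)A + B/(2t)` for every `t > 0`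
  have hle : ∀ t : ℝ, 0 < t → ‖∫ s : UnitAddCircle, k s * v (x + Pi.single j s)‖ ≤ t / 2 * A + 1 / (2 * t) * B := by
    intro t ht
    refine (norm_integral_le_integral_norm _).trans ?_
    have h1 : ∫ s : UnitAddCircle, ‖k s * v (x + Pi.single j s)‖ ≤
        ∫ s : UnitAddCircle, (t / 2 * ‖k s‖ + 1 / (2 * t) * (‖k s‖ * ‖v (x + Pi.single j s)‖ ^ 2)) := by
      refine integral_mono (hI (continuous_norm.comp (hk.mul hvc)))
        (hI ((continuous_const.mul (continuous_norm.comp hk)).add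
          (continuous_const.mul ((continuous_norm.comp hk).mul ((continuous_norm.comp hvc).pow 2))))) fun s => ?_
      simp only [norm_mul]
      have hsq := sq_nonneg (t - ‖v (x + Pi.single j s)‖)
      have hk0 := norm_nonneg (k s)
      have : ‖k s‖ * ‖v (x + Pi.single j s)‖ ≤ ‖k s‖ * (t / 2 + 1 / (2 * t) * ‖v (x + Pi.single j s)‖ ^ 2) := by
        refine mul_le_mul_of_nonneg_left ?_ hk0
        rw [show t / 2 + 1 / (2 * t) * ‖v (x + Pi.single j s)‖ ^ 2 = (t ^ 2 + ‖v (x + Pi.single j s)‖ ^ 2) / (2 * t) by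
          field_simp]
        rw [le_div_iff₀ (by positivity)]
        nlinarith
      linarith
    refine h1.trans (le_of_eq ?_)
    have hIa : Integrable (fun s : UnitAddCircle => t / 2 * ‖k s‖) :=
      hI (continuous_const.mul (continuous_norm.comp hk))
    have hIb : Integrable (fun s : UnitAddCircle => 1 / (2 * t) * (‖k s‖ * ‖v (x + Pi.single j s)‖ ^ 2)) :=
      hI (continuous_const.mul ((continuous_norm.comp hk).mul ((continuous_norm.comp hvc).pow 2)))
    rw [integral_add hIa hIb, integral_const_mul, integral_const_mul]
  -- optimise
  rcases hA0.eq_or_lt with hAz | hAp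
  · -- `A = 0`: the kernel vanishes identically
    have hk0 : ∀ s, k s = 0 := by
      have hcont : Continuous fun s => ‖k s‖ := continuous_norm.comp hk
      have h0 : (fun s => ‖k s‖) = 0 := by
        have := (integral_eq_zero_iff_of_nonneg (fun s => norm_nonneg (k s)) (hI hcont)).mp hAz.symm
        exact hcont.ae_eq_iff_eq (μ := volume) continuous_const |>.mp this
      intro s; exact norm_eq_zero.mp (congrFun h0 s)
    simp_rw [hk0, zero_mul, integral_zero, norm_zero]
    rw [zero_pow two_ne_zero]; exact mul_nonneg hA0 hB0
  rcases hB0.eq_or_lt with hBz | hBp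
  · -- `B = 0`: let `t → ∞`… directly: `‖∫‖ ≤ (t/2)A` for all `t`, hence `0`
    have h0 : ‖∫ s : UnitAddCircle, k s * v (x + Pi.single j s)‖ ≤ 0 := by
      by_contra hne
      push Not at hne
      set N := ‖∫ s : UnitAddCircle, k s * v (x + Pi.single j s)‖ with hN
      have h := hle (N / A) (div_pos hne hAp)
      rw [← hBz, mul_zero, add_zero] at h
      have : N / A / 2 * A = N / 2 := by field_simp
      linarith
    have : ‖∫ s : UnitAddCircle, k s * v (x + Pi.single j s)‖ = 0 := le_antisymm h0 (norm_nonneg _)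
    rw [this, zero_pow two_ne_zero]; exact mul_nonneg hA0 hB0
  · have h := hle (Real.sqrt B / Real.sqrt A) (by positivity)
    have hsA : Real.sqrt A ^ 2 = A := Real.sq_sqrt hAp.le
    have hsB : Real.sqrt B ^ 2 = B := Real.sq_sqrt hBp.le
    have hsA0 : 0 < Real.sqrt A := Real.sqrt_pos.mpr hAp
    have hsB0 : 0 < Real.sqrt B := Real.sqrt_pos.mpr hBp
    have heq : Real.sqrt B / Real.sqrt A / 2 * A + 1 / (2 * (Real.sqrt B / Real.sqrt A)) * B = Real.sqrt A * Real.sqrt B := by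
      field_simp
      nlinarith [hsA, hsB]
    rw [heq] at h
    calc ‖∫ s : UnitAddCircle, k s * v (x + Pi.single j s)‖ ^ 2 ≤ (Real.sqrt A * Real.sqrt B) ^ 2 :=
          pow_le_pow_left₀ (norm_nonneg _) h 2
      _ = A * B := by rw [mul_pow, hsA, hsB]


/-! ## §3 Bounded inputs: the sup-norm-paid weighted energy bound consumed by the window lemma -/

omit [Fintype d] in
/-- For a bounded input, `‖∫ k(s) v(x + s eⱼ) ds‖ ≤ (∫_T |k|) · B`. [folklore] -/
theorem norm_integral_mul_le_of_bound {k : UnitAddCircle → ℂ} (hk : Continuous k) {v : UnitAddTorus d → ℂ}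
    (hv : Continuous v) {B : ℝ} (hB : ∀ y, ‖v y‖ ≤ B) (j : d) (x : UnitAddTorus d) :
    ‖∫ s : UnitAddCircle, k s * v (x + Pi.single j s)‖ ≤ (∫ s : UnitAddCircle, ‖k s‖) * B := by
  have hvc : Continuous fun s : UnitAddCircle => v (x + Pi.single j s) :=
    hv.comp (continuous_const.add ((continuous_single j).comp continuous_id))
  have hI : ∀ {f : UnitAddCircle → ℝ}, Continuous f → Integrable f := fun hf =>
    hf.integrable_of_hasCompactSupport (HasCompactSupport.of_compactSpace _)
  refine (norm_integral_le_integral_norm _).trans ?_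
  rw [← integral_mul_const]
  refine integral_mono (hI (continuous_norm.comp (hk.mul hvc))) (hI ((continuous_norm.comp hk).mul continuous_const))
    fun s => ?_
  simp only [norm_mul]
  exact mul_le_mul_of_nonneg_left (hB _) (norm_nonneg _)

/-- **The zone term of the window lemma for a cut-off bounded scalar.**  For `v` continuous with `‖v‖ ≤ B`, a continuous
weight `ρ` on the circle and a finitely supported symbol `χ`:
`∫ ρ(x_j)² ‖T_χ v(x)‖² dx ≤ (∫_T |k_χ|)² · B² · ∫_T ρ²` (`T_χ v = Σ χ(m)A^j_m v`, `k_χ = Σ χ(m)e_{−m}`): the smooth input split of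
the fibre ledger costs (kernel `L¹` norm)² × (sup norm)² × (mass of the zone weight), uniformly in the frequency scale
(`…AxisKernel.integral_norm_trigPoly_le`). [cite: Grafakos2014, Prop. 3.1.2 (5)] -/
theorem integral_weight_mul_norm_axisCutoff_sq_le {v : UnitAddTorus d → ℂ} (hv : Continuous v) {B : ℝ}
    (hB : ∀ y, ‖v y‖ ≤ B) (j : d) (χ : ℤ → ℂ) (S : Finset ℤ) {ρ : UnitAddCircle → ℝ} (hρ : Continuous ρ) :
    ∫ x : UnitAddTorus d, ρ (x j) ^ 2 *
        ‖∑ m ∈ S, χ m * ∫ s : UnitAddCircle, (fourier (-m) s : ℂ) • v (x + Pi.single j s)‖ ^ 2 ≤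
      (∫ s : UnitAddCircle, ‖∑ m ∈ S, χ m * fourier (-m) s‖) ^ 2 * B ^ 2 * ∫ b : UnitAddCircle, ρ b ^ 2 := by
  have hKc : Continuous fun s : UnitAddCircle => ∑ m ∈ S, χ m * fourier (-m) s :=
    continuous_finsetSum _ fun m _ => continuous_const.mul (fourier (-m)).continuous
  -- pointwise: `ρ(x_j)²‖T_χ v(x)‖² ≤ (A B)² ρ(x_j)²`
  have hpt : ∀ x : UnitAddTorus d, ρ (x j) ^ 2 *
      ‖∑ m ∈ S, χ m * ∫ s : UnitAddCircle, (fourier (-m) s : ℂ) • v (x + Pi.single j s)‖ ^ 2 ≤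
      (∫ s : UnitAddCircle, ‖∑ m ∈ S, χ m * fourier (-m) s‖) ^ 2 * B ^ 2 * ρ (x j) ^ 2 := by
    intro x
    rw [axisCutoff_eq_integral hv j χ S x]
    have h := norm_integral_mul_le_of_bound hKc hv hB j x
    have h2 := pow_le_pow_left₀ (norm_nonneg _) h 2
    rw [mul_pow] at h2
    have h3 := mul_le_mul_of_nonneg_left h2 (sq_nonneg (ρ (x j)))
    linarith
  have hTc : Continuous fun x : UnitAddTorus d =>
      ∑ m ∈ S, χ m * ∫ s : UnitAddCircle, (fourier (-m) s : ℂ) • v (x + Pi.single j s) :=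
    continuous_finsetSum _ fun m _ => continuous_const.mul (continuous_twistedAxisAvg hv j m)
  have hρj : Continuous fun x : UnitAddTorus d => ρ (x j) := hρ.comp (continuous_apply j)
  have hIl : Integrable (fun x : UnitAddTorus d => ρ (x j) ^ 2 *
      ‖∑ m ∈ S, χ m * ∫ s : UnitAddCircle, (fourier (-m) s : ℂ) • v (x + Pi.single j s)‖ ^ 2) volume :=
    ((hρj.pow 2).mul ((continuous_norm.comp hTc).pow 2)).integrable_unitAddTorus
  have hIr : Integrable (fun x : UnitAddTorus d =>
      (∫ s : UnitAddCircle, ‖∑ m ∈ S, χ m * fourier (-m) s‖) ^ 2 * B ^ 2 * ρ (x j) ^ 2) volume :=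
    (continuous_const.mul (hρj.pow 2)).integrable_unitAddTorus
  refine (integral_mono hIl hIr hpt).trans (le_of_eq ?_)
  have hce := K1Flat.integral_comp_eval_eq_integral_circle (d := d) (hρ.pow 2) j
  simp only [Pi.pow_apply] at hce
  rw [integral_const_mul, hce]

end Summit.AnomalousDissipation.AnomalousDissipation.Theorems.SawtoothPulseCascade.K1Window
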